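import Summits.HodgeConjecture.HodgeConjecture.Theorems.PadicSemiregularLiftFormalVectorBundlesAlgebraize
import Literature.AlgebraicGeometry.Morphisms.FormalModuleMixedTorsion
import Literature.AlgebraicGeometry.Morphisms.FormalModuleIsogenyRoofIdeal
import Literature.AlgebraicGeometry.Morphisms.DevissageClass
import Literature.AlgebraicGeometry.FormalGeometry.GrothendieckExistenceVectorBundlesProofs

/-!
# Grothendieck's existence theorem for a PROPER scheme, modulo the uniform unit bound of a Chow cover

Helper file toward row b03 / crux `AnchorTransport.VariationalHodge` (stmt-HodgeConjecture-1076), line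
padic-disc-transport, STUB P: its rungs `…_of_grothendieckExistence` consume the Literature named fact
`Motives.GrothendieckExistence_vectorBundle_witt` (Görtz–Wedhorn II Thm. 24.94 + Prop. 24.95 for every
PROPER `𝒳 / W(k)`), which the tree proves so far only for smooth proper models (Chow cover with
`ρ_*𝒪 = 𝒪`, `…PadicSemiregularLiftFormalVectorBundlesAlgebraize`) and for projective `𝒳`
(`Motives/GrothendieckExistenceWittProjective`). This file carries out the GENERAL proper case of
Grothendieck's existence theorem (GW II Lemma 24.103, second half of the proof; Stacks 088C) in the
tree's tower language, by noetherian induction on the SUPPORT of the tower, modulo ONE explicit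
hypothesis — the uniform bound of GW II Lemma 24.105 for the unit of a Chow cover of the closed
subscheme `V(𝒦)`, stated inline as the section hypothesis `hUB` (no definition, no named fact):

for every ideal sheaf `𝒦 ≠ ⊤` of `X` there are a proper `ρ : X' → X` (a Chow cover of `V(𝒦)`, GW I
Thm. 13.100) with `X'` a closed subscheme of `ℙʳ_A` over `A`, and an ideal sheaf `𝒥` whose support
is strictly smaller than that of `𝒦` (an ideal of definition of the exceptional locus
`V(𝒦) ∖ U`), such that for every coherent formal tower `𝓕` killed by `𝒦` the units
`𝓕_n → ρ_*ρ^*𝓕_n` have kernels and cokernels killed by `(a)ᶜ·𝒥ᵈ` for one pair `(c, d)` and all `n`.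

Given `hUB`:

* `exists_coh_iso_cmplTower_of_isKilledBy_top` — towers killed by `⊤` are zero, hence completion
  towers (base of the induction);
* `exists_coh_iso_cmplTower_of_unitBound` — **every coherent formal tower along `a` on `X` proper
  over the `a`-adically complete noetherian `A` is the completion tower of a coherent `𝒪_X`-module.**
  Induction on the closed subset `T ⊇ supp 𝒦` (`WellFoundedLT (Closeds X)`, `X` noetherian): pull
  the tower back to the projective `X'` and algebraize it there
  (`Morphisms.exists_coh_iso_cmplTower_of_isClosedImmersion_PP`, GW II Lemma 24.103 first half);
  the roof `𝓕 —u→ ρ_*ρ^*𝓕 ≅ ρ_*(𝒢'^) ←v— (ρ_*𝒢')^` with `v` an `a`-power isogeny (theorem on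
  formal functions, `…AlgebraizePushforwardComparison`) and `u` killed by `(a)ᶜ·𝒥ᵈ` yields
  `α : 𝓕 → (ρ_*𝒢')^` with kernels and cokernels killed by a power of `(a)·𝒥`
  (`Morphisms.exists_towerHom_of_roof_of_isKilledBy`); the tricky lemma
  (`Morphisms.exists_coh_iso_of_torsion_kernel_cokernel`, Stacks 088A) with `𝒦 = ⊥` then needs the
  towers killed by `((a)·𝒥)ᵉ`, which reduce to the towers killed by `𝒥ᵉ`
  (`Morphisms.trickyIH_mul_ofIdealTop`) — of support `⊆ supp 𝒥 ⊊ supp 𝒦`, the induction hypothesis;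
* `exists_isVectorBundle_forall_pullback_thickeningι_iso_of_unitBound`,
  `grothendieckExistence_vectorBundle_witt_of_unitBound` — **the two Literature named facts
  `Motives.GrothendieckExistence_vectorBundle_witt` and `FormalGeometry.GortzWedhorn2023_prop2495_wittVector`
  for ALL proper `𝒳 / W(k)` follow from the unit bound** (vector bundles from the algebraized tower:
  `WittScheme.isVectorBundle_and_iso_of_cokernelIsos`, GW II Prop. 24.95 / Lemma 24.96).

What remains for the unconditional facts is exactly GW II Lemma 24.105 in the shape `hUB` (proof in
print: reduce to an affine `V = Spec B`, base change the Chow cover along the flat `Spec B̂ → Spec B`,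
where the tower becomes algebraic and the unit is an isomorphism over the honest open `U`).

HONEST FRAMING: research route conditional on HC_CM; not a corollary; Q11.4-sentence-2 already
refuted in dim ≥ 3. Nothing here bears on `HC_CM`; no case of the Hodge conjecture is proved.

References: GortzWedhorn2023 (II: Lemma 24.103, Construction 24.104, Lemma 24.105, Lemma 24.106,
Thm. 24.94, Prop. 24.95, Lemma 24.96, pp. 566–575); StacksProject (Tags 088A, 088B, 088C);
EGAIII1 (Thm. 5.1.4).
-/

set_option linter.dupNamespace false

noncomputable section

-- Summit.HodgeConjecture.HodgeConjecture.… repeats the summit name by the D-0017 layout (Sub = Summit).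

-- `TopCat.Presheaf`/`Scheme.Modules` are not reducible (as in Mathlib's `AlgebraicGeometry/Modules`).
set_option backward.isDefEq.respectTransparency false

open CategoryTheory CategoryTheory.Limits AlgebraicGeometry TopologicalSpace Opposite
open Literature.AlgebraicGeometry.Modules Literature.AlgebraicGeometry.Morphisms
open Literature.AlgebraicGeometry.Morphisms.ProjCech
open Literature.AlgebraicGeometry.Motives Literature.AlgebraicGeometry.Motives.WittScheme

universe u

namespace Summit.HodgeConjecture.HodgeConjecture.Theorems

namespace GrothendieckExistenceProper

open FormalVectorBundlesAlgebraize

section Ideals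

variable {X : Scheme.{u}}

/-- Powers of ideal sheaves decrease and products are monotone: `(𝒶·𝒥)ᴰ ≤ 𝒶ᶜ·(𝒶ᶜ'·𝒥ᵈ)` for
`c + c' ≤ D`, `d ≤ D`. -/
theorem mul_pow_le_pow_mul_pow_mul (𝒶 J : X.IdealSheafData) {c c' d D : ℕ} (h1 : c + c' ≤ D)
    (h2 : d ≤ D) : (𝒶 * J) ^ D ≤ 𝒶 ^ c * (𝒶 ^ c' * J ^ d) := by
  rw [mul_pow, ← mul_assoc, ← pow_add]
  refine Scheme.IdealSheafData.le_def.mpr fun U => ?_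
  simp only [Scheme.IdealSheafData.ideal_mul, Scheme.IdealSheafData.ideal_pow, Pi.mul_apply,
    Pi.pow_apply]
  exact Ideal.mul_mono (Ideal.pow_le_pow_right h1) (Ideal.pow_le_pow_right h2)

/-- The support of a positive power of an ideal sheaf is the support of the ideal sheaf. -/
theorem support_pow_of_one_le (J : X.IdealSheafData) {e : ℕ} (he : 1 ≤ e) :
    (J ^ e).support = J.support :=
  Scheme.IdealSheafData.support_pow J e (by omega)

end Ideals

section Proper

variable {A : Type u} [CommRing A] [IsNoetherianRing A] {X : Scheme.{u}} (f : X ⟶ Spec (.of A))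
  [IsProper f] (a₀ : A) [IsAdicComplete (Ideal.span {a₀}) A] [IsLocallyNoetherian X] [CompactSpace X]

omit [IsNoetherianRing A] [IsProper f] [IsAdicComplete (Ideal.span {a₀}) A] [IsLocallyNoetherian X]
  [CompactSpace X] in
/-- **Towers killed by the unit ideal sheaf are completion towers** (their levels are zero modules).
Base case of the noetherian induction. -/
theorem exists_coh_iso_cmplTower_of_isKilledBy_top {𝓕 : ℕᵒᵖ ⥤ X.Modules}
    (h𝓕c : ∀ n, Coh (𝓕.obj ⟨n⟩)) (h : ∀ n, IsKilledBy (⊤ : X.IdealSheafData) (𝓕.obj ⟨n⟩)) :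
    ∃ F : X.Modules, Coh F ∧ Nonempty (𝓕 ≅ cmplTower (algebraMapΓ f a₀) F) := by
  have hz : ∀ n, IsZero (𝓕.obj ⟨n⟩) := fun n => by
    rw [IsZero.iff_id_eq_zero]
    refine Scheme.Modules.hom_ext _ _ fun U => ?_
    ext m
    rw [Scheme.Modules.Hom.id_app, Scheme.Modules.Hom.zero_app]
    exact InK.sections_eq_zero_of_affine (InK.sections_eq_zero_of_isKilledBy_top (h n)) U m
  have hz' : ∀ n, IsZero ((cmplTower (algebraMapΓ f a₀) (𝓕.obj ⟨0⟩)).obj ⟨n⟩) := fun n =>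
    IsZero.of_epi (cmplπ (algebraMapΓ f a₀) (𝓕.obj ⟨0⟩) n) (hz 0)
  refine ⟨𝓕.obj ⟨0⟩, h𝓕c 0, ⟨NatIso.ofComponents (fun n => (hz n.unop).iso (hz' n.unop))
    fun _ => (hz _).eq_of_src _ _⟩⟩

variable
  (hUB : ∀ K : X.IdealSheafData, K ≠ ⊤ →
    ∃ (X' : Scheme.{u}) (ρ : X' ⟶ X) (_ : IsProper ρ) (r : ℕ) (ι₀ : X' ⟶ PP A r)
      (_ : IsClosedImmersion ι₀) (_ : ρ ≫ f = strZ ι₀) (J : X.IdealSheafData)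
      (_ : J.support < K.support),
      ∀ 𝓕 : ℕᵒᵖ ⥤ X.Modules, IsFormalTower (algebraMapΓ f a₀) 𝓕 → (∀ n, Coh (𝓕.obj ⟨n⟩)) →
        (∀ n, IsKilledBy K (𝓕.obj ⟨n⟩)) →
        ∃ c d : ℕ, ∀ n : ℕ,
          IsKilledBy (Scheme.IdealSheafData.ofIdealTop (Ideal.span {algebraMapΓ f a₀}) ^ c * J ^ d)
              (kernel ((Scheme.Modules.pullbackPushforwardAdjunction ρ).unit.app (𝓕.obj ⟨n⟩))) ∧
            IsKilledBy (Scheme.IdealSheafData.ofIdealTop (Ideal.span {algebraMapΓ f a₀}) ^ c * J ^ d)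
              (cokernel ((Scheme.Modules.pullbackPushforwardAdjunction ρ).unit.app (𝓕.obj ⟨n⟩))))

include hUB in
/-- **The induction step packaged: a coherent formal tower killed by `𝒦 ≠ ⊤` is algebraizable as
soon as all coherent formal towers killed by ideal sheaves of support `< supp 𝒦` are** (Chow cover
of `V(𝒦)` from `hUB`, algebraization on the projective `X'`, roof, tricky lemma with the ideal
`(a)·𝒥`). -/
theorem exists_coh_iso_cmplTower_step {K : X.IdealSheafData} (hK : K ≠ ⊤)
    (IH : ∀ K' : X.IdealSheafData, K'.support < K.support → ∀ 𝓖 : ℕᵒᵖ ⥤ X.Modules,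
      IsFormalTower (algebraMapΓ f a₀) 𝓖 → (∀ n, Coh (𝓖.obj ⟨n⟩)) →
      (∀ n, IsKilledBy K' (𝓖.obj ⟨n⟩)) →
        ∃ G : X.Modules, Coh G ∧ Nonempty (𝓖 ≅ cmplTower (algebraMapΓ f a₀) G))
    {𝓕 : ℕᵒᵖ ⥤ X.Modules} (hT : IsFormalTower (algebraMapΓ f a₀) 𝓕) (hTc : ∀ n, Coh (𝓕.obj ⟨n⟩))
    (hTK : ∀ n, IsKilledBy K (𝓕.obj ⟨n⟩)) :
    ∃ F : X.Modules, Coh F ∧ Nonempty (𝓕 ≅ cmplTower (algebraMapΓ f a₀) F) := by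
  obtain ⟨X', ρ, hρ, r, ι₀, hι₀, hw, J, hJK, hunit⟩ := hUB K hK
  obtain ⟨c₁, d₁, hu⟩ := hunit 𝓕 hT hTc hTK
  haveI := hρ
  haveI := hι₀
  haveI : IsLocallyNoetherian X' := isLocallyNoetherian_of_isClosedImmersion_PP ι₀
  haveI : CompactSpace X' := compactSpace_of_isClosedImmersion_PP ι₀
  let a : Γ(X, ⊤) := algebraMapΓ f a₀
  let η := (Scheme.Modules.pullbackPushforwardAdjunction ρ).unit
  have ha' : ρ.appTop a = algebraMapΓ (strZ ι₀) a₀ := Sections.appTop_algebraMapΓ f (strZ ι₀) ρ hw a₀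
  -- the inverse image tower on the projective `X'` is a completion tower
  have hT' : IsFormalTower (algebraMapΓ (strZ ι₀) a₀) (𝓕 ⋙ Scheme.Modules.pullback ρ) := by
    rw [← ha']; exact IsFormalTower.comp_pullback ρ a hT
  have hT'c : ∀ n, Coh ((𝓕 ⋙ Scheme.Modules.pullback ρ).obj ⟨n⟩) := fun n => coh_comp_pullback ρ hTc n
  obtain ⟨G', hG', ⟨e⟩⟩ : ∃ G' : X'.Modules, Coh G' ∧
      Nonempty (𝓕 ⋙ Scheme.Modules.pullback ρ ≅ cmplTower (ρ.appTop a) G') := by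
    rw [ha']; exact exists_coh_iso_cmplTower_of_isClosedImmersion_PP a₀ ι₀ hT' hT'c
  -- `H = ρ_*G'` and the comparison `v : H^ → ρ_*(G'^)`, an `a`-power isogeny
  let H : X.Modules := (Scheme.Modules.pushforward ρ).obj G'
  have hH : Coh H := coh_pushforward_of_isProper ρ hG'
  obtain ⟨v, hv⟩ := exists_pushforwardCmplComparison ρ a G'
  obtain ⟨ck, hck⟩ := pushforwardCmplComparison_kernel_torsion ρ a hG' v hv
  obtain ⟨cc, hcc⟩ := pushforwardCmplComparison_cokernel_torsion ρ a hG' v hv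
  -- the roof `𝓕 —u→ P := ρ_*ρ^*𝓕 ←v'— H^`
  let P : ℕᵒᵖ ⥤ X.Modules := (𝓕 ⋙ Scheme.Modules.pullback ρ) ⋙ Scheme.Modules.pushforward ρ
  let u : 𝓕 ⟶ P :=
    { app := fun n => η.app (𝓕.obj n)
      naturality := fun _ _ g => η.naturality (𝓕.map g) }
  let v' : cmplTower a H ⟶ P := v ≫ Functor.whiskerRight e.inv (Scheme.Modules.pushforward ρ)
  have hv'app : ∀ n, v'.app n = v.app n ≫ (Scheme.Modules.pushforward ρ).map (e.inv.app n) :=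
    fun n => rfl
  let ε : ∀ T : X.Modules, T ⟶ T := fun T => globalScalar T (a ^ (ck + cc))
  have hε : ∀ {T T' : X.Modules} (g : T ⟶ T'), ε T ≫ g = g ≫ ε T' := fun g => globalScalar_comp g _
  have hvk : ∀ n : ℕᵒᵖ, kernel.ι (v'.app n) ≫ globalScalar ((cmplTower a H).obj n) (a ^ (ck + cc)) = 0 := by
    intro n
    refine kernel_ι_of_kerBound (a ^ (ck + cc)) (v'.app n) fun z hz => ?_
    rw [hv'app] at hz
    exact kerBound_comp_mono ε (v.app n) _
      (kerBound_of_kernel_ι (a ^ (ck + cc)) (v.app n)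
        (kernel_ι_pow_of_le a (v.app n) (Nat.le_add_right ck cc) (hck n.unop))) z hz
  have hvc : ∀ n : ℕᵒᵖ, globalScalar (P.obj n) (a ^ (ck + cc)) ≫ cokernel.π (v'.app n) = 0 := by
    intro n
    refine cokernel_π_of_cokerBound (a ^ (ck + cc)) (v'.app n) fun q hq => ?_
    rw [hv'app] at hq
    exact cokerBound_comp_epi ε hε (v.app n) _
      (cokerBound_of_cokernel_π (a ^ (ck + cc)) (v.app n)
        (pow_cokernel_π_of_le a (v.app n) (Nat.le_add_left cc ck) (hcc n.unop))) q hq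
  -- the unit is killed by `(a)^c₁·𝒥^d₁`, levelwise; the roof gives `α` killed by `(a)^(2(ck+cc))·(…)`
  have huk : ∀ n : ℕᵒᵖ, IsKilledBy (Scheme.IdealSheafData.ofIdealTop (Ideal.span {a}) ^ c₁ * J ^ d₁)
      (kernel (u.app n)) := fun n => (hu n.unop).1
  have huc : ∀ n : ℕᵒᵖ, IsKilledBy (Scheme.IdealSheafData.ofIdealTop (Ideal.span {a}) ^ c₁ * J ^ d₁)
      (cokernel (u.app n)) := fun n => (hu n.unop).2
  obtain ⟨α, hαk, hαc⟩ := exists_towerHom_of_roof_of_isKilledBy a u v' hvk hvc huk huc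
  -- common exponent `D ≥ 1` for the ideal `(a)·𝒥`
  let D : ℕ := ck + cc + (ck + cc) + c₁ + d₁ + 1
  have hle : (Scheme.IdealSheafData.ofIdealTop (Ideal.span {a}) * J) ^ D ≤
      Scheme.IdealSheafData.ofIdealTop (Ideal.span {a}) ^ (ck + cc + (ck + cc)) *
        (Scheme.IdealSheafData.ofIdealTop (Ideal.span {a}) ^ c₁ * J ^ d₁) :=
    mul_pow_le_pow_mul_pow_mul _ _ (by omega) (by omega)
  -- the tricky lemma along `(a)·𝒥`, with `𝒦 = ⊥`
  refine exists_coh_iso_of_torsion_kernel_cokernel f a₀ hT hTc hH α (K := ⊥)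
    (J := Scheme.IdealSheafData.ofIdealTop (Ideal.span {a}) * J) (d := D)
    (fun n => isKilledBy_bot _) (isKilledBy_bot _)
    (fun n => IsKilledBy.anti hle (hαk ⟨n⟩)) (fun n => IsKilledBy.anti hle (hαc ⟨n⟩)) ?_
  -- its inductive input: towers killed by `((a)·𝒥)ᵉ`, `e ≥ D ≥ 1`, reduce to towers killed by `𝒥ᵉ`,
  -- whose support is `supp 𝒥 < supp 𝒦`
  refine trickyIH_mul_ofIdealTop f a₀ fun e he 𝓖 h𝓖 h𝓖c _ h𝓖J => ?_
  have he1 : 1 ≤ e := le_trans (by omega) he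
  refine IH (J ^ e) ?_ 𝓖 h𝓖 h𝓖c h𝓖J
  rw [support_pow_of_one_le J he1]
  exact hJK

include hUB in
/-- **Grothendieck's existence theorem for a proper scheme, modulo the unit bound** (GW II
Lemma 24.103 / Thm. 24.94, essential surjectivity; EGA III 5.1.4; Stacks 088C): every formal tower of
coherent `𝒪_X`-modules along `a` on `X` proper over the `a`-adically complete noetherian `A` is
isomorphic to the completion tower `(F/aⁿ⁺¹F)_n` of a coherent `𝒪_X`-module `F`. Proof by induction
on the support of the tower (closed subsets of the noetherian space `X`). -/
theorem exists_coh_iso_cmplTower_of_unitBound {𝓕 : ℕᵒᵖ ⥤ X.Modules}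
    (hT : IsFormalTower (algebraMapΓ f a₀) 𝓕) (hTc : ∀ n, Coh (𝓕.obj ⟨n⟩)) :
    ∃ F : X.Modules, Coh F ∧ Nonempty (𝓕 ≅ cmplTower (algebraMapΓ f a₀) F) := by
  haveI : IsNoetherian X := ⟨⟩
  -- claim: for every closed `T`, towers killed by an ideal sheaf of support `≤ T` are algebraizable
  suffices hmain : ∀ (T : Closeds X) (K : X.IdealSheafData), K.support ≤ T →
      ∀ 𝓖 : ℕᵒᵖ ⥤ X.Modules, IsFormalTower (algebraMapΓ f a₀) 𝓖 → (∀ n, Coh (𝓖.obj ⟨n⟩)) →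
      (∀ n, IsKilledBy K (𝓖.obj ⟨n⟩)) →
        ∃ G : X.Modules, Coh G ∧ Nonempty (𝓖 ≅ cmplTower (algebraMapΓ f a₀) G) from
    hmain ⊤ ⊥ le_top 𝓕 hT hTc fun n => isKilledBy_bot _
  intro T
  induction T using WellFoundedLT.induction with
  | ind T IHT =>
    intro K hKT 𝓖 h𝓖 h𝓖c h𝓖K
    by_cases hK : K = ⊤
    · subst hK
      exact exists_coh_iso_cmplTower_of_isKilledBy_top f a₀ h𝓖c h𝓖K
    · exact exists_coh_iso_cmplTower_step f a₀ hUB hK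
        (fun K' hK' 𝓖' h1 h2 h3 => IHT K'.support (lt_of_lt_of_le hK' hKT) K' le_rfl 𝓖' h1 h2 h3)
        h𝓖 h𝓖c h𝓖K

end Proper

/-! ### Vector bundles on proper `W(k)`-schemes, modulo the unit bound -/

section Witt

variable {p : ℕ} [Fact p.Prime] {k : Type} [Field k] [CharP k p] [PerfectRing k p]

/-- **Grothendieck's existence theorem for vector bundles on a PROPER `W(k)`-scheme, modulo the unit
bound** (GW II Thm. 24.94 with Prop. 24.95, general proper case): for `𝒳 / W(k)` proper (`k` perfect
of characteristic `p`) and vector bundles `E_n` on the thickenings `X_{n+1} = 𝒳 ⊗_W W/pⁿ⁺¹` with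
`E_{n+1}|_{X_{n+1}} ≅ E_n`, there is a vector bundle `F` on `𝒳` with `F|_{X_{n+1}} ≅ E_n` for all `n`
— granted the uniform unit bound `hUB` of GW II Lemma 24.105 for `𝒳` (see the module docstring). No
smoothness, flatness or reducedness of `𝒳` is assumed. -/
theorem exists_isVectorBundle_forall_pullback_thickeningι_iso_of_unitBound
    (𝒳 : SchemeOver (WittVector p k)) [IsProper 𝒳.hom]
    (hUB : ∀ K : 𝒳.left.IdealSheafData, K ≠ ⊤ →
      ∃ (X' : Scheme.{0}) (ρ : X' ⟶ 𝒳.left) (_ : IsProper ρ) (r : ℕ) (ι₀ : X' ⟶ PP (WittVector p k) r)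
        (_ : IsClosedImmersion ι₀) (_ : ρ ≫ 𝒳.hom = strZ ι₀) (J : 𝒳.left.IdealSheafData)
        (_ : J.support < K.support),
        ∀ 𝓕 : ℕᵒᵖ ⥤ 𝒳.left.Modules, IsFormalTower (algebraMapΓ 𝒳.hom (p : WittVector p k)) 𝓕 →
          (∀ n, Coh (𝓕.obj ⟨n⟩)) → (∀ n, IsKilledBy K (𝓕.obj ⟨n⟩)) →
          ∃ c d : ℕ, ∀ n : ℕ,
            IsKilledBy (Scheme.IdealSheafData.ofIdealTop
                (Ideal.span {algebraMapΓ 𝒳.hom (p : WittVector p k)}) ^ c * J ^ d)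
                (kernel ((Scheme.Modules.pullbackPushforwardAdjunction ρ).unit.app (𝓕.obj ⟨n⟩))) ∧
              IsKilledBy (Scheme.IdealSheafData.ofIdealTop
                (Ideal.span {algebraMapΓ 𝒳.hom (p : WittVector p k)}) ^ c * J ^ d)
                (cokernel ((Scheme.Modules.pullbackPushforwardAdjunction ρ).unit.app (𝓕.obj ⟨n⟩))))
    (E : ∀ n : ℕ, (thickening 𝒳 (n + 1)).left.Modules) (hE : ∀ n, IsVectorBundle (E n))
    (hcompat : ∀ n, Nonempty ((Scheme.Modules.pullback
      (thickeningMap 𝒳 (Nat.le_succ (n + 1)))).obj (E (n + 1)) ≅ E n)) :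
    ∃ F : 𝒳.left.Modules, IsVectorBundle F ∧
      ∀ n : ℕ, Nonempty ((Scheme.Modules.pullback (thickeningι 𝒳 (n + 1))).obj F ≅ E n) := by
  haveI : IsLocallyNoetherian 𝒳.left := ⟨fun U => isNoetherianRing_sections 𝒳 U.2⟩
  haveI : CompactSpace 𝒳.left := compactSpace_left 𝒳
  -- the direct-image tower `M_n = ι_{n+1*} E_n` along `a = p·1`
  obtain ⟨hcoh, hkill, htrans⟩ := coh_tower_of_formalVectorBundle 𝒳 E hE hcompat
  have hpow : ∀ m, algebraMapΓ 𝒳.hom ((p : WittVector p k) ^ m) =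
      algebraMapΓ 𝒳.hom (p : WittVector p k) ^ m := algebraMapΓ_pow 𝒳
  let a : Γ(𝒳.left, ⊤) := algebraMapΓ 𝒳.hom (p : WittVector p k)
  let M : ℕ → 𝒳.left.Modules := fun n =>
    (Scheme.Modules.pushforward (thickeningι 𝒳 (n + 1))).obj (E n)
  let β : ∀ n, cokernel (globalScalar (M (n + 1)) (a ^ (n + 1))) ≅ M n := fun n =>
    cokernelIsoOfEq (by rw [hpow]) ≪≫ (htrans n).some
  have hk' : ∀ n, globalScalar (M n) (a ^ (n + 1)) = 0 := fun n => by rw [← hpow]; exact hkill n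
  have hT : IsFormalTower a (towerOfIsos a M β) := IsFormalTower.ofIsos _ M β hk'
  have hTc : ∀ n, Coh ((towerOfIsos a M β).obj ⟨n⟩) := fun n => hcoh n
  -- algebraize the tower (Grothendieck's existence theorem for the proper `𝒳`, modulo `hUB`)
  obtain ⟨F, hF, ⟨eF⟩⟩ :=
    exists_coh_iso_cmplTower_of_unitBound 𝒳.hom (p : WittVector p k) hUB hT hTc
  have hFfp : SheafOfModules.IsFinitePresentation F := isFinitePresentation_of_coh F hF
  -- levelwise `F/pⁿ⁺¹F ≅ ι_{n+1*} E_n`, and back to the restriction model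
  have β' : ∀ n, cokernel (globalScalar F (algebraMapΓ 𝒳.hom ((p : WittVector p k) ^ (n + 1)))) ≅
      (Scheme.Modules.pushforward (thickeningι 𝒳 (n + 1))).obj (E n) := fun n =>
    cokernelIsoOfEq (by rw [hpow]) ≪≫ (eF.app ⟨n⟩).symm
  obtain ⟨hFvb, -⟩ := isVectorBundle_and_iso_of_cokernelIsos 𝒳 E hE F hFfp β'
  exact ⟨F, hFvb, fun n => ⟨pullbackThickeningιIso (n + 1) F (β' n)⟩⟩

/-- **`Motives.GrothendieckExistence_vectorBundle_witt` (GW II Thm. 24.94 + Prop. 24.95 for every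
proper `𝒳 / W(k)`) follows from the unit bound of GW II Lemma 24.105**, for all proper `𝒳` at once:
the Literature named fact (and with it `FormalGeometry.GortzWedhorn2023_prop2495_wittVector`, by
`GortzWedhorn2023_prop2495_wittVector_iff_grothendieckExistence_vectorBundle_witt`) is reduced to
that one lemma. -/
theorem grothendieckExistence_vectorBundle_witt_of_unitBound
    (hUB : ∀ (p : ℕ) [Fact p.Prime] (k : Type) [Field k] [CharP k p] [PerfectRing k p]
      (𝒳 : SchemeOver (WittVector p k)), IsProper 𝒳.hom →
      ∀ K : 𝒳.left.IdealSheafData, K ≠ ⊤ →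
      ∃ (X' : Scheme.{0}) (ρ : X' ⟶ 𝒳.left) (_ : IsProper ρ) (r : ℕ) (ι₀ : X' ⟶ PP (WittVector p k) r)
        (_ : IsClosedImmersion ι₀) (_ : ρ ≫ 𝒳.hom = strZ ι₀) (J : 𝒳.left.IdealSheafData)
        (_ : J.support < K.support),
        ∀ 𝓕 : ℕᵒᵖ ⥤ 𝒳.left.Modules, IsFormalTower (algebraMapΓ 𝒳.hom (p : WittVector p k)) 𝓕 →
          (∀ n, Coh (𝓕.obj ⟨n⟩)) → (∀ n, IsKilledBy K (𝓕.obj ⟨n⟩)) →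
          ∃ c d : ℕ, ∀ n : ℕ,
            IsKilledBy (Scheme.IdealSheafData.ofIdealTop
                (Ideal.span {algebraMapΓ 𝒳.hom (p : WittVector p k)}) ^ c * J ^ d)
                (kernel ((Scheme.Modules.pullbackPushforwardAdjunction ρ).unit.app (𝓕.obj ⟨n⟩))) ∧
              IsKilledBy (Scheme.IdealSheafData.ofIdealTop
                (Ideal.span {algebraMapΓ 𝒳.hom (p : WittVector p k)}) ^ c * J ^ d)
                (cokernel ((Scheme.Modules.pullbackPushforwardAdjunction ρ).unit.app (𝓕.obj ⟨n⟩)))) :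
    GrothendieckExistence_vectorBundle_witt.{0} := by
  intro p _ k _ _ _ 𝒳 h𝒳 E hE hstep
  haveI := h𝒳
  obtain ⟨F, hF, e⟩ := exists_isVectorBundle_forall_pullback_thickeningι_iso_of_unitBound 𝒳
    (hUB p k 𝒳 h𝒳) E hE hstep
  exact ⟨F, hF, e 0⟩

end Witt

section WittZero

/-- **`FormalGeometry.GortzWedhorn2023_prop2495_wittVector` follows from the unit bound** (through the equivalence of the two vendored forms of GW II Prop. 24.95). -/
theorem gortzWedhorn2023_prop2495_wittVector_of_unitBound
    (hUB : ∀ (p : ℕ) [Fact p.Prime] (k : Type) [Field k] [CharP k p] [PerfectRing k p]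
      (𝒳 : SchemeOver (WittVector p k)), IsProper 𝒳.hom →
      ∀ K : 𝒳.left.IdealSheafData, K ≠ ⊤ →
      ∃ (X' : Scheme.{0}) (ρ : X' ⟶ 𝒳.left) (_ : IsProper ρ) (r : ℕ)
        (ι₀ : X' ⟶ PP (WittVector p k) r)
        (_ : IsClosedImmersion ι₀) (_ : ρ ≫ 𝒳.hom = strZ ι₀) (J : 𝒳.left.IdealSheafData)
        (_ : J.support < K.support),
        ∀ 𝓕 : ℕᵒᵖ ⥤ 𝒳.left.Modules, IsFormalTower (algebraMapΓ 𝒳.hom (p : WittVector p k)) 𝓕 →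
          (∀ n, Coh (𝓕.obj ⟨n⟩)) → (∀ n, IsKilledBy K (𝓕.obj ⟨n⟩)) →
          ∃ c d : ℕ, ∀ n : ℕ,
            IsKilledBy (Scheme.IdealSheafData.ofIdealTop
                (Ideal.span {algebraMapΓ 𝒳.hom (p : WittVector p k)}) ^ c * J ^ d)
                (kernel ((Scheme.Modules.pullbackPushforwardAdjunction ρ).unit.app (𝓕.obj ⟨n⟩))) ∧
              IsKilledBy (Scheme.IdealSheafData.ofIdealTop
                (Ideal.span {algebraMapΓ 𝒳.hom (p : WittVector p k)}) ^ c * J ^ d)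
                (cokernel ((Scheme.Modules.pullbackPushforwardAdjunction ρ).unit.app (𝓕.obj ⟨n⟩)))) :
    Literature.AlgebraicGeometry.FormalGeometry.GortzWedhorn2023_prop2495_wittVector :=
  Literature.AlgebraicGeometry.FormalGeometry.GortzWedhorn2023_prop2495_wittVector.of_grothendieckExistence_vectorBundle_witt
    (grothendieckExistence_vectorBundle_witt_of_unitBound hUB)

end WittZero

end GrothendieckExistenceProper

end Summit.HodgeConjecture.HodgeConjecture.Theorems

end
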